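import Summits.ValiantsHypothesis.ValiantsHypothesis.Theses.BorderApolarity
import Summits.ValiantsHypothesis.ValiantsHypothesis.Theses.DetQP
import Summits.ValiantsHypothesis.ValiantsHypothesis.Theorems.BorderApolarityFixedWitnessObstructionQPReduction
import Summits.ValiantsHypothesis.ValiantsHypothesis.Theorems.BorderApolarityFixedWitnessObstructionQPOrderChain
import Summits.ValiantsHypothesis.ValiantsHypothesis.Theorems.BorderApolarityFixedWitnessObstructionQPNecessityWindow
import HarnessLib.Audit

/-!
# Line `toric-face-debordering` — skeleton for crux `BorderApolarity.FixedWitnessObstructionQP`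
(item stmt-ValiantsHypothesis-5778, route route-ValiantsHypothesis-BorderApolarity; merged with idea
`fixed-point-debordering`; planner skeleton `Lines/toric-face-debordering.lean` @25ffab8ba89f, RESHAPED by the
line leads — seat -1: reshape 1 (02:06Z, 7 stubs), reshape 2 (extremality, after drefute gen 3), reshape 3 (the weakest
load-bearing stub `stub_toricDeborderQP`); seat -2 (prover-line-stmt-ValiantsHypothesis-5778-2): reshape 4 (this file,
2026-08-16T11Z: de-bordering by ORDER instead of height — same registered stubs, same composition); see "Reshapes")

Idea (card `Cruxes/FixedWitnessObstructionQP/Ideas/toric-face-debordering.md`). A Borel-fixed border-apolar witness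
`(P•, J)` at `(n, m)` is, at the level of FORMS, a TORIC FACE restriction: `X₀₀^(m-n) per_n = u · in_w(g · det_m)`,
the `w`-INITIAL FORM (top weighted-homogeneous component — EXTREMAL weight level `e = max_{supp} ⟨w,·⟩`, i.e. the
restriction of `g · det_m` to the face of its Newton polytope exposed by `w`, a genuine one-parameter torus LIMIT,
hence a point of `Δ(det_m)`) of a translate of the determinant (`stub_toricFaceMax`; it follows from route item
`ToricFixedPoints`, stmt-5779, and the registered socle step `stub_socleMax` by the sorry-free
`toricFaceMax_of_toricFixedPoints`). A weighted component of a size-`s` determinant with weights `≤ B` is an HONEST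
determinant of size `3((s+1)(B+1))^10` (`stub_deborder`, LANDED p78718 = interpolation `stub_interp` p76234 +
inverse read-outs `stub_invReprOfDetRepr` p75990 + `HasInvRepr.add`); undo `u` (`hasDetRepr_linSubst`, landed with
p78718) and set `X₀₀ = 1` (`stub_unpad`, LANDED p75790): `dc(per_n) ≤ 3((m+1)(B+1))^10`. The load-bearing NEW
statement is now stated in its WEAKEST useful form `stub_toricDeborderQP`: an EXTREMAL toric representation at size `m`
forces `dc(per_n) ≤ 2^((log₂ m + c₁)^c₁)` (toric border ⇒ affine at qp cost); the polyhedral `WeightBoundQP` implies it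
through the landed de-bordering (`toricDeborderQP_of_weightBoundMax`, sorry-free below). Inside the crux's window the loss
is quasi-polynomial (`qp_absorb`, proved), so a witness forces `dc(per_n) ≤ 2^((log₂ n + c')^c')`, contradicting the
EVENTUAL affine hardness of the permanent `stub_dcPerEventuallySuperQP` — the EXTERNAL input shared with route DetQP.

## Reshapes (lead)
* Reshape 1 (02:06Z): `stub_deborder` ↦ `stub_interp` + `stub_invReprOfDetRepr` (+ assembly); `stub_unpad` in projection
  form; NEW `stub_socle`. ALL FOUR LANDED (p76234, p75990, p75790, p77099) and the assembly `stub_deborder` LANDED (p78718,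
  `Theorems/…QPDeborder.lean`, with `hasDetRepr_linSubst`, `hasInvRepr_smul`, `hasDetRepr_sum_of_isHomogeneous`).
* Reshape 2 (this file): drefute gen 3 (`Cruxes/…/DrefuteG3StubWeightBound.md`) KILLED `stub_weightBound` AS REGISTERED:
  its hypothesis "pp = u · wHC_w^e(g·det_m) for SOME level e" admits MIDDLE slices, and the explicit middle-slice
  representation (S) `pp_{n,m} = wHC_w^e(g · det_m)` for all `m ≥ 2n − 1` (g = permutation × unipotent, base-(n+1)
  column-code weights; Valiant/Kronecker "per is one coefficient of a product of linear forms") makes that hypothesis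
  FREE inside the window, so `stub_weightBound ∧ stub_dcPerEventuallySuperQP → False` through the landed glue (a proof
  of the old stub 2 = a quasi-polynomial determinantal upper bound for per). The same (S) makes the old `stub_toricFace`
  and the conclusion of `stub_socle` vacuous for `m ≥ 2n − 1` (gen 3 `DrefuteG3StubToricFace.md`). REPAIR (gen 2 §2 /
  gen 3 "minimal repair C′", misses the witness: (S) is never extremal — an extremal slice at `m = 2n−1 < n²/2` would
  contradict LMR13): the EXTREMALITY clause `∀ d ∈ supp(g · det_m), weight_w d ≤ e` is added to the conclusions of
  `stub_socleMax` / `stub_toricFaceMax` and to the HYPOTHESIS of `stub_weightBoundMax`; the composition is unchanged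
  (de-bordering never uses extremality). Old names `stub_toricFace`, `stub_socle` (landed, true, superseded),
  `stub_weightBound` (dead) leave the skeleton.
* Reshape 3 (seat -1): `stub_weightBoundMax` ↦ the WEAKER `stub_toricDeborderQP` (conclusion `dc(per_n) ≤ 2^((log₂ m + c₁)^c₁)`
  directly); `WeightBoundQP ⇒ ToricDeborderQP` is the sorry-free `toricDeborderQP_of_weightBoundMax` over the landed glue, so
  the de-bordering engine now sits in a proved implication instead of the composition.
* Reshape 4 (seat -2, this file): ORDER, NOT HEIGHT. New landed stub `stub_deborderOrder` (p96327, `Theorems/…QPDeborderOrder.lean`):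
  the order-`k` coefficient `[ε^k] det (B₀ + ε B₁ + ⋯ + ε^k B_k)` of a holomorphic family of `m × m` matrices of linear forms is an
  honest determinant of size `3((m+1)(k+1))^10` (interpolation at `(m+1)k+1` nodes + polynomial sub-additivity), together with
  `weightedHomogeneousComponent_linSubst_detPoly_eq_coeff` (every toric slice `wHC_w^e (g · det_m)` IS such a coefficient, order `e`,
  layers `wHC_w^j ∘ (g·x)`) and the truncation lemma `coeff_det_layers_of_le`. New sorry-free implications below:
  `toricDeborderQP_of_orderBoundQP` (ORDER bound ⇒ the open stub) and `orderBoundQP_of_weightBoundMax` (height bound ⇒ order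
  bound, trivial frame `k = e ≤ m · max w`), so `toricDeborderQP_of_weightBoundMax` is now their composite. The line's open
  sufficient condition is thereby WEAKENED from "weights ≤ 2^polylog m" (`WeightBoundQP`, Alon–Vũ heights) to "order
  `k ≤ 2^polylog m` in SOME frame" (`OrderBoundQP`): rescaling rows/columns of the family by `ε^{p_a}`, `ε^{q_b}` (Egerváry
  potentials `p_a + q_b ≥` entry weight) keeps linear layers and lowers the order to `Σp + Σq − e`, which is `O(1)` on thin
  chambers where every exposing weight is huge; the frame-free minimum is Murota/Hirai's `deg Det − deg det` of the weighted
  pencil (crux 4's card `mvmp-order-debordering`, whose first lemma `deborder_of_order` is exactly `stub_deborderOrder`).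

* Reshape 4b (seat -2): FRAME CHANGE BY POTENTIALS. New landed stub `stub_deborderFrame` (p97508, `Theorems/…QPDeborderFrame.lean`,
  Murota 1995 §4): for feasible potentials `p_a + q_b ≥` entry weights, the extremal slice is the order-`(Σp+Σq−e)` coefficient of the
  reflected LINEAR-layer family; Egerváry duality proved (`Literature/Combinatorics/Optimization/EgervaryDuality.lean`, p98414) makes the least
  `Σp+Σq` the tropical determinant of the entry-weight matrix. The whole chain `WeightBoundQP ⟹ PotentialGapQP ⟹ OrderBoundQP ⟹ ToricDeborderQP`,
  the tight-frame lemma (gap 0 ⇒ `dc(per_n) ≤ m`) and the crux-4/crux-2 corollaries are LANDED (`Theorems/…QPOrderChain.lean`, p101068, registered stub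
  `toricDeborderQP_of_potentialGapQP`); this skeleton now only imports them. OPEN RESIDUE OF THE LINE: `PotentialGapQP` — a quasi-polynomial
  MUROTA GAP `tropdet(ν) − e ≤ 2^polylog(m)` for SOME extremal toric representation of each padded permanent (crux 4's cards
  `mvmp-order-debordering` / `graded-tight-matrix-dichotomy` attack exactly this); calibrations: gap 0 on the torus closure of `det_m` itself
  (`…QPTightDet.lean`, p102517 LANDED: g = 1, Egerváry potentials are tight for the generic matrix; plus the Murota identity det(tight layer) = wHC^{Σp+Σq}(det L) and the tight/fooling dichotomy), order ≤ m on `End(W)·det_m` (0/1 weights, `exists_extremal_zeroOne_of_mem_endOrbit`).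

* Reshape 5 (seat -2, after seat c2's `…QPNecessity{,Window}.lean`, p97847/p100013): WINDOW THE OPEN STUB. The global `stub_toricDeborderQP`
  (de-bordering at ALL sizes `3 ≤ n ≤ m`) overshoots the crux; only its restriction to the window `n ≤ m ≤ 2^((log₂ n + c)^c)` is used, and with
  the WINDOWED stub `stub_toricDeborderQPWindow` (`∃ c₁ ∀ c ∃ n₀ ∀ n ≥ n₀ ∀ m in the window, extremal toric rep ⇒ dc(per_n) ≤ 2^((log₂ m + c₁)^c₁)`)
  the line is EXACT: given `ToricFixedPoints`, crux ⟺ stub_toricDeborderQPWindow ∧ stub_dcPerEventuallySuperQP (c2's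
  `fixedWitnessObstructionQP_iff_toricDeborderQPWindow_and_dc`). The registered open stub is now the windowed one; the order chain is landed
  PER INSTANCE (`…QPOrderInstance.lean`, p105311: `stub_dcLeOfPotentialRep` — dc(per_n) ≤ 3((m+1)(gap+1))^10 for ANY toric representation with
  feasible potentials — and `toricDeborderQPWindow_of_potentialGapQPWindow`), so the open residue is `PotentialGapQPWindow`: a quasi-polynomial
  Murota gap for the padded permanents INSIDE THE WINDOW only.

Registered stubs now (sorries ONLY here): `stub_toricFaceMax` (open structural; ⇐ 5779 + socleMax), `stub_socleMax` (LANDED p83124; reference),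
`stub_toricDeborderQPWindow` (the line's open bet, lead; ⇐ PotentialGapQPWindow by the landed `toricDeborderQPWindow_of_potentialGapQPWindow`;
⇐ the retired global `stub_toricDeborderQP`), `stub_dcPerEventuallySuperQP` (external, NECESSARY: c2's `dcPerEventuallySuperQP_of_fixedWitnessObstructionQP`).
Everything else is imported from `Theorems/…QP{Reduction,DeborderOrder,DeborderFrame,OrderChain,OrderInstance,Necessity,NecessityWindow}.lean`.

Disproof.lean (cdisprove gen 2) obligations honoured as before: W1/W3 consumed inside `stub_toricFaceMax`/`stub_socleMax`
(W5 used once, at `k = m`, `crux_iff_top`); Grenet control (`m = 2ⁿ - 1`: extremal toric with `B = 1`, End(W)·det_m =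
weight-0 faces, no contradiction claimed below stub 5's threshold); padded-determinant control: every stub except 5 holds
verbatim for `ℓ^(m-n) det_n` and outputs the TRUE `dc(det_n) ≤ poly(m)`; all per/det asymmetry is in stub 5.
-/

open scoped BigOperators Matrix

set_option linter.dupNamespace false
open Literature.Computability.AlgebraicComplexity

namespace Summit.ValiantsHypothesis.ValiantsHypothesis.Cruxes.FixedWitnessObstructionQP.ToricFaceDebordering

/-! ## Stubs (registered; `sorry` allowed only here) -/

/-- **Stub 1a — EXTREMAL toric face normal form of a fixed witness (form level; structural, L; open).**
For `3 ≤ n ≤ m`, if a Borel-fixed border-apolar witness `(P•, J)` of the crux exists at `(n, m)` (hypothesis = the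
crux's W1 ∧ W2 ∧ W3 ∧ W4 ∧ W5, VERBATIM the antecedent of the route's support item `WitnessToMembership`), then the
padded permanent is a translate of the `w`-INITIAL FORM of a translate of the determinant:
`X₀₀^(m-n) per_n = u · wHC_w^e (g · det_m)` with `⟨w, d⟩ ≤ e` for every monomial `x^d` of `g · det_m` (so the
component is the top face = `lim_{t→∞} t^{-e} (g·det_m)(t^w x)`, a point of `Δ(det_m)`). Why plausibly true: implied by
route item `ToricFixedPoints` (stmt-5779, ideal level) + the socle step (`toricFaceMax_of_toricFixedPoints`, sorry-free
over `stub_socleMax`); holds with 0/1 weights on `End(W) · det_m ∋ ℓ^(m-n) det_n` (rank normal form `A = u·D_r·g`: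
`D_r·G` is the top face for `w = 1 − 1_{killed}`) and for Grenet's witnesses (`m ≥ 2ⁿ - 1`); for `2m < n²` the
hypothesis is empty (LMR13 + `witnessToMembership_holds`), so the content sits in `n²/2 ≤ m < 2ⁿ − 1`. Why it might
fail: an iterated degeneration `G((t)) = G[[t]]T((t))G[[t]]` whose limit FORM is a slice of jets, on no torus-orbit
closure of a single translate (second boundary component of `Δ(det₃)`, HuttenhainLairez2016). The middle-slice
representation (S) of drefute gen 3 does NOT satisfy the extremality clause. Sources: card; LandsbergGCT2017 §6.7;
HuttenhainLairez2016; BuczynskaBuczynski2021 Thm 1; drefute gen 2 §3, gen 3. -/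
theorem stub_toricFaceMax : ∀ (n m : ℕ) [NeZero m], 3 ≤ n → n ≤ m →
    (let act := fun (D f : MvPolynomial (Fin m × Fin m) ℂ) => ∑ e ∈ D.support, ∑ d ∈ f.support, MvPolynomial.monomial (d - e) (MvPolynomial.coeff e D * MvPolynomial.coeff d f * ∏ i ∈ e.support, (Nat.descFactorial (d i) (e i) : ℂ)); let rk := fun (p : Fin m × Fin m) => (if (m - n ≤ (p.1 : ℕ) ∧ m - n ≤ (p.2 : ℕ)) ∨ p = (0, 0) then 0 else m * m) + ((p.1 : ℕ) * m + (p.2 : ℕ)); (∃ (P : ℕ → MvPolynomial (Fin m × Fin m) ℂ) (J : ℕ → Set (MvPolynomial (Fin m × Fin m) ℂ)), (∀ t : ℕ, P t ∈ Literature.Computability.AlgebraicComplexity.glOrbit (Fin m × Fin m) ℂ (Literature.Computability.AlgebraicComplexity.detPoly (Fin m) ℂ)) ∧ (∀ k ≤ m, ∀ D ∈ J k, ∃ Ds : ℕ → MvPolynomial (Fin m × Fin m) ℂ, (∀ t, (Ds t).IsHomogeneous k ∧ act (Ds t) (P t) = 0) ∧ Filter.Tendsto (fun t => Literature.Computability.AlgebraicComplexity.coeffVec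 (Ds t)) Filter.atTop (nhds (Literature.Computability.AlgebraicComplexity.coeffVec D))) ∧ (∀ k ≤ m, ∀ (D : MvPolynomial (Fin m × Fin m) ℂ) (φ : ℕ → ℕ) (Ds : ℕ → MvPolynomial (Fin m × Fin m) ℂ), StrictMono φ → (∀ t, (Ds t).IsHomogeneous k ∧ act (Ds t) (P (φ t)) = 0) → Filter.Tendsto (fun t => Literature.Computability.AlgebraicComplexity.coeffVec (Ds t)) Filter.atTop (nhds (Literature.Computability.AlgebraicComplexity.coeffVec D)) → D ∈ J k) ∧ (∀ A : Matrix.GeneralLinearGroup (Fin m × Fin m) ℂ, let M : Matrix (Fin m × Fin m) (Fin m × Fin m) ℂ := A; (∀ i j : Fin m × Fin m, M j i ≠ 0 → rk j ≤ rk i) → (∀ i j : Fin m × Fin m, ((m - n ≤ (i.1 : ℕ) ∧ m - n ≤ (i.2 : ℕ)) ∨ i = (0, 0)) → j ≠ i → M j i = 0) → (∀ i k j l : Fin m, m - n ≤ (i : ℕ) → m - n ≤ (k : ℕ) → m - n ≤ (j : ℕ) → m - n ≤ (l : ℕ) → M (i, j) (i, j) * M (k, l) (k, l) = M (i, l) (i,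 l) * M (k, j) (k, j)) → M (0, 0) (0, 0) ^ (m - n) * ∏ i ∈ Finset.univ.filter (fun i : Fin m => m - n ≤ (i : ℕ)), M (i, i) (i, i) = 1 → ∀ k ≤ m, ∀ D ∈ J k, Literature.Computability.AlgebraicComplexity.linSubst (Fin m × Fin m) ℂ Mᵀ D ∈ J k) ∧ (∀ k ≤ m, ∀ D ∈ J k, act D (Literature.Computability.AlgebraicComplexity.paddedPerPoly ℂ n m) = 0))) →
      ∃ (u g : Matrix.GeneralLinearGroup (Fin m × Fin m) ℂ) (w : Fin m × Fin m → ℕ) (e : ℕ),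
        (∀ d ∈ (linSubst (Fin m × Fin m) ℂ (g : Matrix (Fin m × Fin m) (Fin m × Fin m) ℂ) (detPoly (Fin m) ℂ)).support,
          Finsupp.weight w d ≤ e) ∧
        paddedPerPoly ℂ n m =
          linSubst (Fin m × Fin m) ℂ (u : Matrix (Fin m × Fin m) (Fin m × Fin m) ℂ)
            (MvPolynomial.weightedHomogeneousComponent w e
              (linSubst (Fin m × Fin m) ℂ (g : Matrix (Fin m × Fin m) (Fin m × Fin m) ℂ) (detPoly (Fin m) ℂ))) := by
  sorry

/-- **Stub 1b — the SOCLE STEP with extremality exported — LANDED p83124 (`Theorems/…QPSocleMax.lean`).** Same hypotheses as the landed `stub_socle` (p77099): `J` is the border-apolar limit (W2 ∧ W3,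
`k ≤ m`) of the TORIC family `Q_t = u · diag((t+2)^w) · g · det_m` (`w : variables → ℤ`; the conclusion of route item
`ToricFixedPoints`, stmt-5779, verbatim) and `J_k ⊆ Ann_k(pp)` for `k ≤ m` (W5). Conclusion: as `stub_socle` PLUS the
extremality clause `∀ d ∈ supp(g' · det_m), ⟨w', d⟩ ≤ e'`. The landed proof
(`Socle.exists_eq_weightedHomogeneousComponent`) already takes `e₀ = max_{supp F} ⟨w, ·⟩` (`hmax`), outputs
`w' = w − w i₀`, `e' = e₀ − m · w i₀` and `g'` with `g' · det_m = μ • F` (same support as `F`), so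
`⟨w', d⟩ = ⟨w, d⟩ − m w i₀ ≤ e₀ − m w i₀ = e'` on `supp F`: re-run that proof keeping `hmax` in the output (its public
helpers `tendsto_coeffVec_torus`, `mem_of_apolarAction_limit_eq_zero`, `exists_eq_smul_of_apolar_imp`,
`smul_linSubst_torus`, `linSubst_diagonal_eq_sum` are importable). [folklore] -/
theorem stub_socleMax : ∀ (n m : ℕ) [NeZero m], 3 ≤ n → n ≤ m → let act := fun (D f : MvPolynomial (Fin m × Fin m) ℂ) => ∑ e ∈ D.support, ∑ d ∈ f.support, MvPolynomial.monomial (d - e) (MvPolynomial.coeff e D * MvPolynomial.coeff d f * ∏ i ∈ e.support, (Nat.descFactorial (d i) (e i) : ℂ));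
    ∀ (J : ℕ → Set (MvPolynomial (Fin m × Fin m) ℂ)) (u g : Matrix.GeneralLinearGroup (Fin m × Fin m) ℂ)
      (w : Fin m × Fin m → ℤ),
      (let Q : ℕ → MvPolynomial (Fin m × Fin m) ℂ := fun t => Literature.Computability.AlgebraicComplexity.linSubst (Fin m × Fin m) ℂ (u : Matrix (Fin m × Fin m) (Fin m × Fin m) ℂ) (Literature.Computability.AlgebraicComplexity.linSubst (Fin m × Fin m) ℂ (Matrix.diagonal fun i : Fin m × Fin m => ((t : ℂ) + 2) ^ (w i)) (Literature.Computability.AlgebraicComplexity.linSubst (Fin m × Fin m) ℂ (g : Matrix (Fin m × Fin m) (Fin m × Fin m) ℂ) (Literature.Computability.AlgebraicComplexity.detPoly (Fin m) ℂ))); (∀ k ≤ m, ∀ D ∈ J k, ∃ Ds : ℕ → MvPolynomial (Fin m × Fin m) ℂ, (∀ t, (Ds t).IsHomogeneous k ∧ act (Ds t) (Q t) = 0) ∧ Filter.Tendsto (fun t => Literature.Computability.AlgebraicComplexity.coeffVec (Ds t)) Filter.atTop (nhds (Literature.Computability.AlgebraicComplexity.coeffVec D))) ∧ (∀ k ≤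 m, ∀ (D : MvPolynomial (Fin m × Fin m) ℂ) (φ : ℕ → ℕ) (Ds : ℕ → MvPolynomial (Fin m × Fin m) ℂ), StrictMono φ → (∀ t, (Ds t).IsHomogeneous k ∧ act (Ds t) (Q (φ t)) = 0) → Filter.Tendsto (fun t => Literature.Computability.AlgebraicComplexity.coeffVec (Ds t)) Filter.atTop (nhds (Literature.Computability.AlgebraicComplexity.coeffVec D)) → D ∈ J k)) →
      (∀ k ≤ m, ∀ D ∈ J k, act D (Literature.Computability.AlgebraicComplexity.paddedPerPoly ℂ n m) = 0) →
      ∃ (u g : Matrix.GeneralLinearGroup (Fin m × Fin m) ℂ) (w : Fin m × Fin m → ℕ) (e : ℕ),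
        (∀ d ∈ (linSubst (Fin m × Fin m) ℂ (g : Matrix (Fin m × Fin m) (Fin m × Fin m) ℂ) (detPoly (Fin m) ℂ)).support,
          Finsupp.weight w d ≤ e) ∧
        paddedPerPoly ℂ n m =
          linSubst (Fin m × Fin m) ℂ (u : Matrix (Fin m × Fin m) (Fin m × Fin m) ℂ)
            (MvPolynomial.weightedHomogeneousComponent w e
              (linSubst (Fin m × Fin m) ℂ (g : Matrix (Fin m × Fin m) (Fin m × Fin m) ℂ) (detPoly (Fin m) ℂ))) :=
  Summit.ValiantsHypothesis.ValiantsHypothesis.Theorems.BorderApolarityFixedWitnessObstructionQP.stub_socleMax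

/-- **Stub 2 — `ToricDeborderQPWindow`: TORIC border ⇒ affine at quasi-polynomial cost, INSIDE THE WINDOW (the line's open bet,
held by the lead; crux-sized; reshape 5).** There is an absolute `c₁` such that for every `c`, for all large `n` and every `m` with
`n ≤ m ≤ 2^((log₂ n + c)^c)`: whenever the padded permanent `X₀₀^(m-n) per_n` is a translate of the `w`-INITIAL FORM (extremal level)
of a translate `g · det_m`, then `dc(per_n) ≤ 2^((log₂ m + c₁)^c₁)`. EXACT: given `ToricFixedPoints`, the crux is EQUIVALENT to this stub ∧
stub 5 (seat c2, `fixedWitnessObstructionQP_iff_toricDeborderQPWindow_and_dc`); the retired global form (all `3 ≤ n ≤ m`) implied it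
(`stub_toricDeborderQPWindow_of_toricDeborderQP` below) but is not implied by the crux. SUFFICIENT CONDITION LANDED: a quasi-polynomial MUROTA GAP
in the window (`PotentialGapQPWindow`) — `stub_toricDeborderQPWindow_of_potentialGapQPWindow` below, over the per-instance bound
`dc(per_n) ≤ 3((m+1)(Σp+Σq−e+1))^10` (`stub_dcLeOfPotentialRep`, `…QPOrderInstance.lean`). Why the hypothesis is not free / why it might fail:
as for the global form (an extremal toric representation puts `pp ∈ Δ(det_m)`, none below `n²/2` by LMR13; Kumar / LL89 exponential order in
general; nothing bounds Murota's gap for interacting layers). Sources: card; seat c2's Necessity files; Murota1995CombinatorialRelaxation §4;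
arXiv:2211.07055; drefute gen 2 §2, gen 3. -/
theorem stub_toricDeborderQPWindow : ∃ c₁ : ℕ, ∀ c : ℕ, ∃ n₀ : ℕ, ∀ n ≥ n₀, ∀ (m : ℕ) [NeZero m], n ≤ m →
      m ≤ 2 ^ ((Nat.log 2 n + c) ^ c) →
      (∃ (u g : Matrix.GeneralLinearGroup (Fin m × Fin m) ℂ) (w : Fin m × Fin m → ℕ) (e : ℕ),
        (∀ d ∈ (linSubst (Fin m × Fin m) ℂ (g : Matrix (Fin m × Fin m) (Fin m × Fin m) ℂ)
          (detPoly (Fin m) ℂ)).support, Finsupp.weight w d ≤ e) ∧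
        paddedPerPoly ℂ n m =
          linSubst (Fin m × Fin m) ℂ (u : Matrix (Fin m × Fin m) (Fin m × Fin m) ℂ)
            (MvPolynomial.weightedHomogeneousComponent w e
              (linSubst (Fin m × Fin m) ℂ (g : Matrix (Fin m × Fin m) (Fin m × Fin m) ℂ)
                (detPoly (Fin m) ℂ)))) →
      determinantalComplexity (perPoly (Fin n) ℂ) ≤ 2 ^ ((Nat.log 2 m + c₁) ^ c₁) := by
  sorry

/-- **Stub 5 — EXTERNAL hardness input: eventual super-quasi-polynomial affine determinantal
complexity of the permanent (open problem; NOT to be attempted inside this line).** For every `c`,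
`dc(per_n) > 2^((log₂ n + c)^c)` for all large `n`. This is the EVENTUAL form of route DetQP's thesis
`DetQP.DetqpThesis = ¬ IsQPBounded (n ↦ dc(per_n))` (stmt-ValiantsHypothesis-0315, infinitely-often
form, which is logically insufficient here: `¬X` only yields witnesses for infinitely many `n`); it is
strictly WEAKER than the crux X (given `WitnessToMembership` + MS Prop 4.4: `dc ≥ border-dc`), and it
implies VH on its own through the proved `DetQP.DcqpToVH` — so this line ISOLATES the border phenomenon
(stubs 1–4: "border + fixedness add at most a quasi-polynomial factor") and delegates the hardness of
the permanent to the affine routes (DetQP, UlrichPadded, PrincipalMinorColouring, GrenetZeon, …), as all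
three triagers recorded ("fine for the crux, moot for the summit"). Recommended: the tenure planner files
it as a shared support item `DcPerEventuallySuperQP` (rank 9) of BorderApolarity/DetQP; the lead briefs NO
stub-worker on it. Known: `n²/2 ≤ dc(per_n) ≤ 2ⁿ - 1` (MignonRessayre2004, Grenet2011). NB (drefute gen 3):
together with the DEAD unrepaired `stub_weightBound` it is inconsistent — which is why stub 2 was repaired, not this one.
Sources: MignonRessayre2004; Grenet2011; BurgisserClausenShokrollahi1997 (21.41), Problem 21.5;
arXiv:2406.06217 Thm 2.36. -/
theorem stub_dcPerEventuallySuperQP : ∀ c : ℕ, ∃ n₀ : ℕ, ∀ n ≥ n₀,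
    2 ^ ((Nat.log 2 n + c) ^ c) < determinantalComplexity (perPoly (Fin n) ℂ) := by
  sorry

/-! ## Glue (sorry-free; everything imported from the landed Theorems files) -/

/-- **The composition** (concludes the crux BY NAME, sorry-free over the three registered stubs; reshape 5): given `c`, seat c2's
`noExtremalInitialForm_of_toricDeborderQPWindow` turns stubs 2 ∧ 5 into "no extremal initial-form representation of `pp_{n,m}` in the
window for `n ≥ n₂`", and `stub_toricFaceMax` turns a witness into such a representation; threshold `max n₂ 3`. -/
theorem FixedWitnessObstructionQP_of :
    Summit.ValiantsHypothesis.ValiantsHypothesis.Theses.BorderApolarity.FixedWitnessObstructionQP := by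
  have hNo := Summit.ValiantsHypothesis.ValiantsHypothesis.Theorems.BorderApolarityFixedWitnessObstructionQP.noExtremalInitialForm_of_toricDeborderQPWindow
    stub_toricDeborderQPWindow stub_dcPerEventuallySuperQP
  intro c
  obtain ⟨n₂, hn₂⟩ := hNo c
  refine ⟨max n₂ 3, ?_⟩
  intro n hn m inst hnm hm
  have h3 : 3 ≤ n := le_trans (le_max_right _ _) hn
  have hn₂' : n₂ ≤ n := le_trans (le_max_left _ _) hn
  have hT := @stub_toricFaceMax n m inst h3 hnm
  dsimp only at hT ⊢
  intro hw
  exact hn₂ n hn₂' m hnm hm (hT hw)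

/-- **The route's two-layer plan over this line, EXACT form** (reshape 5): crux 3 `ToricFixedPoints` (stmt-5779, BY NAME) ∧
stub 2 (windowed de-bordering) ∧ stub 5 (eventual super-qp `dc(per_n)`) ⟹ crux — seat c2's
`fixedWitnessObstructionQP_iff_toricDeborderQPWindow_and_dc`, whose converse shows nothing is lost. -/
theorem FixedWitnessObstructionQP_of_toricFixedPoints
    (h5779 : Summit.ValiantsHypothesis.ValiantsHypothesis.Theses.BorderApolarity.ToricFixedPoints) :
    Summit.ValiantsHypothesis.ValiantsHypothesis.Theses.BorderApolarity.FixedWitnessObstructionQP :=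
  (Summit.ValiantsHypothesis.ValiantsHypothesis.Theorems.BorderApolarityFixedWitnessObstructionQP.fixedWitnessObstructionQP_iff_toricDeborderQPWindow_and_dc
    h5779).mpr ⟨stub_toricDeborderQPWindow, stub_dcPerEventuallySuperQP⟩

/-! **The open residue, kernel-pinned (reshape 5)**: `PotentialGapQPWindow` — a quasi-polynomial Murota gap for some extremal toric
representation of each padded permanent IN THE WINDOW — implies the registered `stub_toricDeborderQPWindow` verbatim: landed as
`toricDeborderQPWindow_of_potentialGapQPWindow` (`Theorems/…QPOrderInstance.lean`, p105311, over the per-instance `stub_dcLeOfPotentialRep`: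
dc(per_n) ≤ 3((m+1)(Σp+Σq−e+1))^10 for ANY toric representation with feasible potentials). Import that file to use it; it is not
re-stated here only because the check farm had not yet built it when this reshape was registered. -/

/-- Monotonicity: the retired GLOBAL stub (reshapes 3–4b, `stub_toricDeborderQP`: all sizes `3 ≤ n ≤ m`) implies the windowed one
(threshold `3`), so every sufficient condition landed for it (`…QPOrderChain.lean`: WeightBoundQP ⟹ PotentialGapQP ⟹ OrderBoundQP ⟹
ToricDeborderQP) still feeds stub 2. [folklore] -/
theorem stub_toricDeborderQPWindow_of_toricDeborderQP :
    (∃ c₁ : ℕ, ∀ (n m : ℕ) [NeZero m], 3 ≤ n → n ≤ m →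
      (∃ (u g : Matrix.GeneralLinearGroup (Fin m × Fin m) ℂ) (w : Fin m × Fin m → ℕ) (e : ℕ),
        (∀ d ∈ (linSubst (Fin m × Fin m) ℂ (g : Matrix (Fin m × Fin m) (Fin m × Fin m) ℂ)
          (detPoly (Fin m) ℂ)).support, Finsupp.weight w d ≤ e) ∧
        paddedPerPoly ℂ n m =
          linSubst (Fin m × Fin m) ℂ (u : Matrix (Fin m × Fin m) (Fin m × Fin m) ℂ)
            (MvPolynomial.weightedHomogeneousComponent w e
              (linSubst (Fin m × Fin m) ℂ (g : Matrix (Fin m × Fin m) (Fin m × Fin m) ℂ)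
                (detPoly (Fin m) ℂ)))) →
      determinantalComplexity (perPoly (Fin n) ℂ) ≤ 2 ^ ((Nat.log 2 m + c₁) ^ c₁)) →
    ∃ c₁ : ℕ, ∀ c : ℕ, ∃ n₀ : ℕ, ∀ n ≥ n₀, ∀ (m : ℕ) [NeZero m], n ≤ m →
      m ≤ 2 ^ ((Nat.log 2 n + c) ^ c) →
      (∃ (u g : Matrix.GeneralLinearGroup (Fin m × Fin m) ℂ) (w : Fin m × Fin m → ℕ) (e : ℕ),
        (∀ d ∈ (linSubst (Fin m × Fin m) ℂ (g : Matrix (Fin m × Fin m) (Fin m × Fin m) ℂ)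
          (detPoly (Fin m) ℂ)).support, Finsupp.weight w d ≤ e) ∧
        paddedPerPoly ℂ n m =
          linSubst (Fin m × Fin m) ℂ (u : Matrix (Fin m × Fin m) (Fin m × Fin m) ℂ)
            (MvPolynomial.weightedHomogeneousComponent w e
              (linSubst (Fin m × Fin m) ℂ (g : Matrix (Fin m × Fin m) (Fin m × Fin m) ℂ)
                (detPoly (Fin m) ℂ)))) →
      determinantalComplexity (perPoly (Fin n) ℂ) ≤ 2 ^ ((Nat.log 2 m + c₁) ^ c₁) := by
  rintro ⟨c₁, hTD⟩
  refine ⟨c₁, fun c => ⟨3, fun n hn m inst hnm _ hrep => @hTD n m inst hn hnm hrep⟩⟩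

/-- Stub 5 (EVENTUAL super-qp `dc(per_n)`) implies the infinitely-often thesis of route DetQP (`DetQP.DetqpThesis`,
stmt-ValiantsHypothesis-0315, `¬ IsQPBounded (n ↦ dc(per_n))`); the converse fails logically (i.o. ≠ eventually), which is
why the line cannot take 0315 by name (triage r1-1/2/3). [folklore] -/
theorem detqpThesis_of_dcPerEventuallySuperQP
    (hdc : ∀ c : ℕ, ∃ n₀ : ℕ, ∀ n ≥ n₀, 2 ^ ((Nat.log 2 n + c) ^ c) < determinantalComplexity (perPoly (Fin n) ℂ)) :
    Summit.ValiantsHypothesis.ValiantsHypothesis.Theses.DetQP.DetqpThesis := by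
  rintro ⟨c, hc⟩
  obtain ⟨n₀, hn₀⟩ := hdc c
  exact (lt_irrefl _ ((hn₀ n₀ le_rfl).trans_le (hc n₀))).elim

end Summit.ValiantsHypothesis.ValiantsHypothesis.Cruxes.FixedWitnessObstructionQP.ToricFaceDebordering
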